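import Summits.QuantumFields.YangMills.Theorems.BalabanUVNodesN15TwoGridEntry2Split
import HarnessLib

/-!
# N15 (NE2) — Bałaban's full propagator pair, part 67: ENTRY 2 — the FIVE-PIECE SPLIT of `S = T2†` and the adjoints of its three «rough» pieces

WHO / WHEN.  Cell `pub-ymgap`, seat `pub-ymgap-dag-n15-a` (KNIT-BY-NAME, g13); `--supports stmt-QuantumFields-20507 --as helper` (count-neutral); `HOME/pub-ymgap-dag-n15-a/DOOR-IV-PLAN.md` §7
(entry 2).  Over parts 65 (`entry2_adjoint_step1`, `sLap_comp_ravg_sub`, `isAdj_entry2`), 63 (the `wdot`∕`LinearMap.IsAdjointPair` calculus, `ravg`, `isAdj_pull_ravg`), 46 (`deltaOp_eq`).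
WHAT.  `T2_μ = idef P P (G′∇′_μ*) (G∇_μ*)` («G∇*», the derivative on the ROUGH source) has the η-weighted adjoint `S = R∇′_μG′ − ∇_μGR` (`R` = King's block average = `P†`).
(§100) ★ `entry2_adjoint_split`: `S = S₁ + S₂ − N₃ − N₄ + N₅` with `S₁ = R(1−A_μ)∇′_μG′`, `S₂ = ∇_μG[Σ_ν ∇_ν^* R(A_ν−1)∇′_ν]G′`, `N₃ = ∇_μG[Σ_ν R(1−Ā_ν)∇′_ν*∇′_ν]G′`,
`N₄ = ∇_μG(VR − RV′)G′`, `N₅ = ∇_μG(a𝒬*𝒬R − Ra𝒬′*𝒬′)G′` (`Δ_a = Δ − V + a𝒬*𝒬` on both grids, `Δ_aG = 1`, the exact intertwinings `∇R = RA∇′`, `∇*R = RĀ∇′*` of part 65).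
(§101) `isAdj_symbOp_finsum`, `isAdj_sA_sAbar` (`ρ(a_ν)† = ρ(ā_ν)`); ★ `isAdj_N3`, `isAdj_N4`, `isAdj_N5`: the adjoints `N₃† = G′[Σ_ν ∇′_ν*∇′_ν(1−A_ν)P]G∇_μ*`,
`N₄† = G′(PV − V′P)G∇_μ*`, `N₅† = G′(Pa𝒬*𝒬 − a𝒬′*𝒬′P)G∇_μ*` (coarse → fine); (§102) ★★ `isAdj_entry2_T`: `T2 + N₃† + N₄† − N₅†` is adjoint to the «smooth» part `S₁ + S₂`.
WHY.  `S₁`, `S₂` carry the derivative on `G′` resp. on both resolvents with a filter defect `1 − A = O(η)·∇′` in between — (1.114) L² entries; `N₃, N₄, N₅` would need a third derivative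
∕ the Landau and averaging defects on the L² side, so they are moved to the `T`-side where their adjoints are SUP-small (sharp-prolongation transfers of parts 44∕45∕53∕57 on «G∇*», whose
one-step oscillation is part 66).  Part 68 turns this into `HasMaj (sup → L²) T2`.
HONEST FRAMING ∕ LIMITS.  Exact finite-lattice algebra at `U ≡ 1`; count-neutral (typed 28∕28 · discharged 5∕27 of record unchanged); NOT a discharge of N15 (`NE2PlusOperator`,
object-bound); not ℝ⁴ ∕ OS ∕ mass gap ∕ Clay.
-/

open scoped BigOperators
open Finset

namespace Summit.QuantumFields.YangMills.BalabanUVNodes.N15.TwoGrid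

open Literature.MathematicalPhysics.QuantumFieldTheory.Balaban1983to89
open Literature.MathematicalPhysics.QuantumFieldTheory.Balaban1983to89.T4EtaRateDefect (idef)
open Literature.MathematicalPhysics.QuantumFieldTheory.Balaban1983to89.T4EtaRateCoeffDefect (pull)
open Literature.MathematicalPhysics.QuantumFieldTheory.Balaban1983to89.B5Prop11Plancherel (Tor fine)
open Literature.MathematicalPhysics.QuantumFieldTheory.Balaban1983to89.B5SettingP12Weighted (etaPow)
open Summit.QuantumFields.YangMills.BalabanUVNodes.N15.VectorPiece (kingPrV)

variable {d : ℕ}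

/-! ## §101 (first half) Adjoint calculus complements -/

section Calculus

variable {X₁ X₂ : Type} [Fintype X₁] [Fintype X₂] {w₁ w₂ : ℝ}

variable (M : Fin (d + 1) → ℕ) [∀ μ, NeZero (M μ)] (n : ℕ) [NeZero n] {w : ℝ}

/-- finite sums of symbols. [folklore] -/
theorem isAdj_symbOp_finsum {ι : Type} (s : Finset ι) {σ σ' : ι → AddMonoidAlgebra ℝ (Tor (fine n M))}
    (h : ∀ i ∈ s, LinearMap.IsAdjointPair (wdot w) (wdot w) (symbOp M n (σ i)) (symbOp M n (σ' i))) :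
    LinearMap.IsAdjointPair (wdot w) (wdot w) (symbOp M n (∑ i ∈ s, σ i)) (symbOp M n (∑ i ∈ s, σ' i)) := by
  rw [map_sum, map_sum]; exact isAdjW_sum s h

/-- **`ρ(a_ν)† = ρ(ā_ν)`**: the forward box filter `a_ν = R⁻¹Σ_{j<R} s_ν^j` against the backward one `ā_ν = R⁻¹Σ_{j<R} s_ν^{−j}`. [folklore] -/
theorem isAdj_sA_sAbar (ν : Fin (d + 1)) (R : ℕ) :
    LinearMap.IsAdjointPair (wdot w) (wdot w) (symbOp M n (sA M n ν R)) (symbOp M n ((R : ℝ)⁻¹ • ∑ j ∈ range R, sTinv M n ν ^ j)) := by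
  rw [sA]
  exact isAdj_symbOp_smul M n (isAdj_symbOp_finsum M n (range R) fun j _ => isAdj_sT_pow M n ν j) _

end Calculus

/-! ## §100 ★ The five-piece split of `S = T2†` -/

section Split

variable {L : ℕ} [NeZero L] (M : Fin (d + 1) → ℕ) [∀ μ, NeZero (M μ)] (k m : ℕ) (a : ℝ)

/-- ★ **THE FIVE-PIECE SPLIT** `S = S₁ + S₂ − N₃ − N₄ + N₅` of `S = R∇′_μG′ − ∇_μGR` (see the module docstring for the pieces): part 65's step 1, `Δ_a = Δ − V + a𝒬*𝒬`
(`deltaOp_eq`) on both grids and the Laplacian consistency `ΔR − RΔ′ = Σ_ν ∇_ν^*R(A_ν−1)∇′_ν − Σ_ν R(1−Ā_ν)∇′_ν*∇′_ν` (`sLap_comp_ravg_sub`).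
[cite: Balaban1984PropagatorsI, (1.69)–(1.73) pp.29–30] -/
theorem entry2_adjoint_split (ha : 0 < a) (μ : Fin (d + 1)) :
    ravg M L k m ∘ₗ (symbOp M (L ^ m * L ^ k) (sD M (L ^ m * L ^ k) μ ((L ^ m * L ^ k : ℕ) : ℝ)) ∘ₗ gOp M (L ^ m * L ^ k) a)
        - (symbOp M (L ^ k) (sD M (L ^ k) μ ((L ^ k : ℕ) : ℝ)) ∘ₗ gOp M (L ^ k) a) ∘ₗ ravg M L k m
      = ravg M L k m ∘ₗ symbOp M (L ^ m * L ^ k) (1 - sA M (L ^ m * L ^ k) μ (L ^ m)) ∘ₗ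
            symbOp M (L ^ m * L ^ k) (sD M (L ^ m * L ^ k) μ ((L ^ m * L ^ k : ℕ) : ℝ)) ∘ₗ gOp M (L ^ m * L ^ k) a
        + symbOp M (L ^ k) (sD M (L ^ k) μ ((L ^ k : ℕ) : ℝ)) ∘ₗ gOp M (L ^ k) a ∘ₗ
            (∑ ν : Fin (d + 1), symbOp M (L ^ k) (((L ^ k : ℕ) : ℝ) • (sTinv M (L ^ k) ν - 1)) ∘ₗ ravg M L k m ∘ₗ
              symbOp M (L ^ m * L ^ k) (sA M (L ^ m * L ^ k) ν (L ^ m) - 1) ∘ₗ symbOp M (L ^ m * L ^ k) (sD M (L ^ m * L ^ k) ν ((L ^ m * L ^ k : ℕ) : ℝ))) ∘ₗ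
            gOp M (L ^ m * L ^ k) a
        - symbOp M (L ^ k) (sD M (L ^ k) μ ((L ^ k : ℕ) : ℝ)) ∘ₗ gOp M (L ^ k) a ∘ₗ
            (∑ ν : Fin (d + 1), ravg M L k m ∘ₗ symbOp M (L ^ m * L ^ k) (1 - ((L ^ m : ℕ) : ℝ)⁻¹ • ∑ j ∈ range (L ^ m), sTinv M (L ^ m * L ^ k) ν ^ j) ∘ₗ
              symbOp M (L ^ m * L ^ k) (((L ^ m * L ^ k : ℕ) : ℝ) • (sTinv M (L ^ m * L ^ k) ν - 1)) ∘ₗ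
                symbOp M (L ^ m * L ^ k) (sD M (L ^ m * L ^ k) ν ((L ^ m * L ^ k : ℕ) : ℝ))) ∘ₗ
            gOp M (L ^ m * L ^ k) a
        - symbOp M (L ^ k) (sD M (L ^ k) μ ((L ^ k : ℕ) : ℝ)) ∘ₗ gOp M (L ^ k) a ∘ₗ
            (landauRe M (L ^ k) ∘ₗ ravg M L k m - ravg M L k m ∘ₗ landauRe M (L ^ m * L ^ k)) ∘ₗ gOp M (L ^ m * L ^ k) a
        + symbOp M (L ^ k) (sD M (L ^ k) μ ((L ^ k : ℕ) : ℝ)) ∘ₗ gOp M (L ^ k) a ∘ₗ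
            ((a • (qvAdjRe M (L ^ k) ∘ₗ qvRe M (L ^ k))) ∘ₗ ravg M L k m - ravg M L k m ∘ₗ (a • (qvAdjRe M (L ^ m * L ^ k) ∘ₗ qvRe M (L ^ m * L ^ k)))) ∘ₗ
            gOp M (L ^ m * L ^ k) a := by
  rw [entry2_adjoint_step1 M k m a ha μ]
  have hΔ : deltaOp M (L ^ k) a ∘ₗ ravg M L k m - ravg M L k m ∘ₗ deltaOp M (L ^ m * L ^ k) a
      = (symbOp M (L ^ k) (sLap M (L ^ k) ((L ^ k : ℕ) : ℝ)) ∘ₗ ravg M L k m - ravg M L k m ∘ₗ symbOp M (L ^ m * L ^ k) (sLap M (L ^ m * L ^ k) ((L ^ m * L ^ k : ℕ) : ℝ)))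
        - (landauRe M (L ^ k) ∘ₗ ravg M L k m - ravg M L k m ∘ₗ landauRe M (L ^ m * L ^ k))
        + ((a • (qvAdjRe M (L ^ k) ∘ₗ qvRe M (L ^ k))) ∘ₗ ravg M L k m - ravg M L k m ∘ₗ (a • (qvAdjRe M (L ^ m * L ^ k) ∘ₗ qvRe M (L ^ m * L ^ k)))) := by
    rw [deltaOp_eq, deltaOp_eq]
    simp only [LinearMap.sub_comp, LinearMap.add_comp, LinearMap.comp_sub, LinearMap.comp_add]
    abel
  rw [hΔ, sLap_comp_ravg_sub]
  simp only [LinearMap.comp_sub, LinearMap.comp_add, LinearMap.sub_comp, LinearMap.add_comp]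
  abel

end Split

/-! ## §101 ★ The adjoints of the three «rough» pieces -/

section Adjoints

variable {L : ℕ} [NeZero L] (M : Fin (d + 1) → ℕ) [∀ μ, NeZero (M μ)] (k m : ℕ) (a : ℝ)

/-- ★ **`N₃† = G′[Σ_ν ∇′_ν*∇′_ν(1 − A_ν)P]G∇_μ*`** is adjoint (weights `η^D`, `η′^D`) to `N₃ = ∇_μG[Σ_ν R(1 − Ā_ν)∇′_ν*∇′_ν]G′`. [cite: Balaban1984PropagatorsI, (1.31) p.23] -/
theorem isAdj_N3 (ha : 0 < a) (μ : Fin (d + 1)) :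
    LinearMap.IsAdjointPair (wdot (etaPow (L ^ k) (d + 1))) (wdot (etaPow (L ^ m * L ^ k) (d + 1)))
      (gOp M (L ^ m * L ^ k) a ∘ₗ
        (∑ ν : Fin (d + 1), symbOp M (L ^ m * L ^ k) (((L ^ m * L ^ k : ℕ) : ℝ) • (sTinv M (L ^ m * L ^ k) ν - 1)) ∘ₗ
          symbOp M (L ^ m * L ^ k) (sD M (L ^ m * L ^ k) ν ((L ^ m * L ^ k : ℕ) : ℝ)) ∘ₗ symbOp M (L ^ m * L ^ k) (1 - sA M (L ^ m * L ^ k) ν (L ^ m)) ∘ₗ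
            pull (kingPrV L k m M)) ∘ₗ
        gOp M (L ^ k) a ∘ₗ symbOp M (L ^ k) (((L ^ k : ℕ) : ℝ) • (sTinv M (L ^ k) μ - 1)))
      (symbOp M (L ^ k) (sD M (L ^ k) μ ((L ^ k : ℕ) : ℝ)) ∘ₗ gOp M (L ^ k) a ∘ₗ
        (∑ ν : Fin (d + 1), ravg M L k m ∘ₗ symbOp M (L ^ m * L ^ k) (1 - ((L ^ m : ℕ) : ℝ)⁻¹ • ∑ j ∈ range (L ^ m), sTinv M (L ^ m * L ^ k) ν ^ j) ∘ₗ
          symbOp M (L ^ m * L ^ k) (((L ^ m * L ^ k : ℕ) : ℝ) • (sTinv M (L ^ m * L ^ k) ν - 1)) ∘ₗ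
            symbOp M (L ^ m * L ^ k) (sD M (L ^ m * L ^ k) ν ((L ^ m * L ^ k : ℕ) : ℝ))) ∘ₗ
        gOp M (L ^ m * L ^ k) a) := by
  have hL0 : 0 < L := Nat.pos_of_ne_zero (NeZero.ne L)
  have hn1 : 1 ≤ L ^ k := Nat.one_le_pow _ _ hL0
  have hn'1 : 1 ≤ L ^ m * L ^ k := Nat.one_le_iff_ne_zero.mpr (Nat.mul_ne_zero (pow_ne_zero m (NeZero.ne L)) (pow_ne_zero k (NeZero.ne L)))
  have hP := isAdj_pull_ravg (d := d) M L k m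
  have hGDb : LinearMap.IsAdjointPair (wdot (etaPow (L ^ k) (d + 1))) (wdot (etaPow (L ^ k) (d + 1)))
      (gOp M (L ^ k) a ∘ₗ symbOp M (L ^ k) (((L ^ k : ℕ) : ℝ) • (sTinv M (L ^ k) μ - 1)))
      (symbOp M (L ^ k) (sD M (L ^ k) μ ((L ^ k : ℕ) : ℝ)) ∘ₗ gOp M (L ^ k) a) :=
    isAdjW_comp (isAdj_gOp M (L ^ k) a hn1 ha) (isAdj_sDbar M _ μ _)
  have hS : LinearMap.IsAdjointPair (wdot (etaPow (L ^ k) (d + 1))) (wdot (etaPow (L ^ m * L ^ k) (d + 1)))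
      ⇑(∑ ν : Fin (d + 1), symbOp M (L ^ m * L ^ k) (((L ^ m * L ^ k : ℕ) : ℝ) • (sTinv M (L ^ m * L ^ k) ν - 1)) ∘ₗ
          symbOp M (L ^ m * L ^ k) (sD M (L ^ m * L ^ k) ν ((L ^ m * L ^ k : ℕ) : ℝ)) ∘ₗ symbOp M (L ^ m * L ^ k) (1 - sA M (L ^ m * L ^ k) ν (L ^ m)) ∘ₗ
            pull (kingPrV L k m M))
      ⇑(∑ ν : Fin (d + 1), ((ravg M L k m ∘ₗ symbOp M (L ^ m * L ^ k) (1 - ((L ^ m : ℕ) : ℝ)⁻¹ • ∑ j ∈ range (L ^ m), sTinv M (L ^ m * L ^ k) ν ^ j)) ∘ₗ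
          symbOp M (L ^ m * L ^ k) (((L ^ m * L ^ k : ℕ) : ℝ) • (sTinv M (L ^ m * L ^ k) ν - 1))) ∘ₗ
            symbOp M (L ^ m * L ^ k) (sD M (L ^ m * L ^ k) ν ((L ^ m * L ^ k : ℕ) : ℝ))) :=
    isAdjW_sum univ fun ν _ =>
      isAdjW_comp (isAdj_sDbar M _ ν _) (isAdjW_comp (isAdj_sD M _ ν _)
        (isAdjW_comp (isAdj_symbOp_sub M _ (isAdj_symbOp_one M _) (isAdj_sA_sAbar M _ ν (L ^ m))) hP))
  have h := isAdjW_comp (isAdj_gOp M (L ^ m * L ^ k) a hn'1 ha) (isAdjW_comp hS hGDb)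
  refine isAdjW_congr h rfl (LinearMap.ext fun f => ?_)
  simp only [LinearMap.comp_apply, LinearMap.sum_apply, Nat.cast_pow]

/-- ★ **`N₄† = G′(PV − V′P)G∇_μ*`** is adjoint to `N₄ = ∇_μG(VR − RV′)G′` (`V† = V`, part 63). [cite: Balaban1984PropagatorsI, (1.69)–(1.70) p.29] -/
theorem isAdj_N4 (ha : 0 < a) (μ : Fin (d + 1)) :
    LinearMap.IsAdjointPair (wdot (etaPow (L ^ k) (d + 1))) (wdot (etaPow (L ^ m * L ^ k) (d + 1)))
      (gOp M (L ^ m * L ^ k) a ∘ₗ (pull (kingPrV L k m M) ∘ₗ landauRe M (L ^ k) - landauRe M (L ^ m * L ^ k) ∘ₗ pull (kingPrV L k m M)) ∘ₗ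
        gOp M (L ^ k) a ∘ₗ symbOp M (L ^ k) (((L ^ k : ℕ) : ℝ) • (sTinv M (L ^ k) μ - 1)))
      (symbOp M (L ^ k) (sD M (L ^ k) μ ((L ^ k : ℕ) : ℝ)) ∘ₗ gOp M (L ^ k) a ∘ₗ
        (landauRe M (L ^ k) ∘ₗ ravg M L k m - ravg M L k m ∘ₗ landauRe M (L ^ m * L ^ k)) ∘ₗ gOp M (L ^ m * L ^ k) a) := by
  have hL0 : 0 < L := Nat.pos_of_ne_zero (NeZero.ne L)
  have hn1 : 1 ≤ L ^ k := Nat.one_le_pow _ _ hL0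
  have hn'1 : 1 ≤ L ^ m * L ^ k := Nat.one_le_iff_ne_zero.mpr (Nat.mul_ne_zero (pow_ne_zero m (NeZero.ne L)) (pow_ne_zero k (NeZero.ne L)))
  have hP := isAdj_pull_ravg (d := d) M L k m
  have hGDb : LinearMap.IsAdjointPair (wdot (etaPow (L ^ k) (d + 1))) (wdot (etaPow (L ^ k) (d + 1)))
      (gOp M (L ^ k) a ∘ₗ symbOp M (L ^ k) (((L ^ k : ℕ) : ℝ) • (sTinv M (L ^ k) μ - 1)))
      (symbOp M (L ^ k) (sD M (L ^ k) μ ((L ^ k : ℕ) : ℝ)) ∘ₗ gOp M (L ^ k) a) :=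
    isAdjW_comp (isAdj_gOp M (L ^ k) a hn1 ha) (isAdj_sDbar M _ μ _)
  have hmid := isAdjW_sub (isAdjW_comp hP (isAdj_landauRe (w := etaPow (L ^ k) (d + 1)) M (L ^ k)))
    (isAdjW_comp (isAdj_landauRe (w := etaPow (L ^ m * L ^ k) (d + 1)) M (L ^ m * L ^ k)) hP)
  have h := isAdjW_comp (isAdj_gOp M (L ^ m * L ^ k) a hn'1 ha) (isAdjW_comp hmid hGDb)
  refine isAdjW_congr h rfl (LinearMap.ext fun f => ?_)
  simp only [LinearMap.comp_apply, LinearMap.sub_apply]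

/-- ★ **`N₅† = G′(P·a𝒬*𝒬 − a𝒬′*𝒬′·P)G∇_μ*`** is adjoint to `N₅ = ∇_μG(a𝒬*𝒬R − R·a𝒬′*𝒬′)G′` (`(a𝒬*𝒬)† = a𝒬*𝒬`, part 63). [cite: Balaban1984PropagatorsI, (1.69), (1.73) pp.29–30] -/
theorem isAdj_N5 (ha : 0 < a) (μ : Fin (d + 1)) :
    LinearMap.IsAdjointPair (wdot (etaPow (L ^ k) (d + 1))) (wdot (etaPow (L ^ m * L ^ k) (d + 1)))
      (gOp M (L ^ m * L ^ k) a ∘ₗ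
        (pull (kingPrV L k m M) ∘ₗ (a • (qvAdjRe M (L ^ k) ∘ₗ qvRe M (L ^ k))) - (a • (qvAdjRe M (L ^ m * L ^ k) ∘ₗ qvRe M (L ^ m * L ^ k))) ∘ₗ pull (kingPrV L k m M)) ∘ₗ
        gOp M (L ^ k) a ∘ₗ symbOp M (L ^ k) (((L ^ k : ℕ) : ℝ) • (sTinv M (L ^ k) μ - 1)))
      (symbOp M (L ^ k) (sD M (L ^ k) μ ((L ^ k : ℕ) : ℝ)) ∘ₗ gOp M (L ^ k) a ∘ₗ
        ((a • (qvAdjRe M (L ^ k) ∘ₗ qvRe M (L ^ k))) ∘ₗ ravg M L k m - ravg M L k m ∘ₗ (a • (qvAdjRe M (L ^ m * L ^ k) ∘ₗ qvRe M (L ^ m * L ^ k)))) ∘ₗ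
        gOp M (L ^ m * L ^ k) a) := by
  have hL0 : 0 < L := Nat.pos_of_ne_zero (NeZero.ne L)
  have hn1 : 1 ≤ L ^ k := Nat.one_le_pow _ _ hL0
  have hn'1 : 1 ≤ L ^ m * L ^ k := Nat.one_le_iff_ne_zero.mpr (Nat.mul_ne_zero (pow_ne_zero m (NeZero.ne L)) (pow_ne_zero k (NeZero.ne L)))
  have hP := isAdj_pull_ravg (d := d) M L k m
  have hGDb : LinearMap.IsAdjointPair (wdot (etaPow (L ^ k) (d + 1))) (wdot (etaPow (L ^ k) (d + 1)))
      (gOp M (L ^ k) a ∘ₗ symbOp M (L ^ k) (((L ^ k : ℕ) : ℝ) • (sTinv M (L ^ k) μ - 1)))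
      (symbOp M (L ^ k) (sD M (L ^ k) μ ((L ^ k : ℕ) : ℝ)) ∘ₗ gOp M (L ^ k) a) :=
    isAdjW_comp (isAdj_gOp M (L ^ k) a hn1 ha) (isAdj_sDbar M _ μ _)
  have hmid := isAdjW_sub (isAdjW_comp hP (isAdj_qq (w := etaPow (L ^ k) (d + 1)) M (L ^ k) a hn1 ha))
    (isAdjW_comp (isAdj_qq (w := etaPow (L ^ m * L ^ k) (d + 1)) M (L ^ m * L ^ k) a hn'1 ha) hP)
  have h := isAdjW_comp (isAdj_gOp M (L ^ m * L ^ k) a hn'1 ha) (isAdjW_comp hmid hGDb)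
  refine isAdjW_congr h rfl (LinearMap.ext fun f => ?_)
  simp only [LinearMap.comp_apply, LinearMap.sub_apply]

/-! ## §102 ★★ `T2 + N₃† + N₄† − N₅†` is adjoint to the smooth part `S₁ + S₂` -/

/-- ★★ **THE DUALITY INPUT OF ENTRY 2**: with `S₁ = R(1−A_μ)∇′_μG′` and `S₂ = ∇_μG[Σ_ν ∇_ν^*R(A_ν−1)∇′_ν]G′`, the coarse→fine operator `T2 + N₃† + N₄† − N₅†` is adjoint
(weights `η^D`, `η′^D`) to `S₁ + S₂` — §100 and §101 combined with part 65's `isAdj_entry2`. [cite: Balaban1984PropagatorsI, (1.69)–(1.73) pp.29–30, Prop. 1.2 (1.114) p.36] -/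
theorem isAdj_entry2_T (ha : 0 < a) (μ : Fin (d + 1)) :
    LinearMap.IsAdjointPair (wdot (etaPow (L ^ k) (d + 1))) (wdot (etaPow (L ^ m * L ^ k) (d + 1)))
      ⇑(idef (pull (kingPrV L k m M)) (pull (kingPrV L k m M))
          (gOp M (L ^ m * L ^ k) a ∘ₗ symbOp M (L ^ m * L ^ k) (((L ^ m * L ^ k : ℕ) : ℝ) • (sTinv M (L ^ m * L ^ k) μ - 1)))
          (gOp M (L ^ k) a ∘ₗ symbOp M (L ^ k) (((L ^ k : ℕ) : ℝ) • (sTinv M (L ^ k) μ - 1)))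
        + gOp M (L ^ m * L ^ k) a ∘ₗ
          (∑ ν : Fin (d + 1), symbOp M (L ^ m * L ^ k) (((L ^ m * L ^ k : ℕ) : ℝ) • (sTinv M (L ^ m * L ^ k) ν - 1)) ∘ₗ
            symbOp M (L ^ m * L ^ k) (sD M (L ^ m * L ^ k) ν ((L ^ m * L ^ k : ℕ) : ℝ)) ∘ₗ symbOp M (L ^ m * L ^ k) (1 - sA M (L ^ m * L ^ k) ν (L ^ m)) ∘ₗ
              pull (kingPrV L k m M)) ∘ₗ
          gOp M (L ^ k) a ∘ₗ symbOp M (L ^ k) (((L ^ k : ℕ) : ℝ) • (sTinv M (L ^ k) μ - 1))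
        + gOp M (L ^ m * L ^ k) a ∘ₗ (pull (kingPrV L k m M) ∘ₗ landauRe M (L ^ k) - landauRe M (L ^ m * L ^ k) ∘ₗ pull (kingPrV L k m M)) ∘ₗ
          gOp M (L ^ k) a ∘ₗ symbOp M (L ^ k) (((L ^ k : ℕ) : ℝ) • (sTinv M (L ^ k) μ - 1))
        - gOp M (L ^ m * L ^ k) a ∘ₗ
          (pull (kingPrV L k m M) ∘ₗ (a • (qvAdjRe M (L ^ k) ∘ₗ qvRe M (L ^ k))) - (a • (qvAdjRe M (L ^ m * L ^ k) ∘ₗ qvRe M (L ^ m * L ^ k))) ∘ₗ pull (kingPrV L k m M)) ∘ₗ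
          gOp M (L ^ k) a ∘ₗ symbOp M (L ^ k) (((L ^ k : ℕ) : ℝ) • (sTinv M (L ^ k) μ - 1)))
      ⇑(ravg M L k m ∘ₗ symbOp M (L ^ m * L ^ k) (1 - sA M (L ^ m * L ^ k) μ (L ^ m)) ∘ₗ
            symbOp M (L ^ m * L ^ k) (sD M (L ^ m * L ^ k) μ ((L ^ m * L ^ k : ℕ) : ℝ)) ∘ₗ gOp M (L ^ m * L ^ k) a
        + symbOp M (L ^ k) (sD M (L ^ k) μ ((L ^ k : ℕ) : ℝ)) ∘ₗ gOp M (L ^ k) a ∘ₗ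
            (∑ ν : Fin (d + 1), symbOp M (L ^ k) (((L ^ k : ℕ) : ℝ) • (sTinv M (L ^ k) ν - 1)) ∘ₗ ravg M L k m ∘ₗ
              symbOp M (L ^ m * L ^ k) (sA M (L ^ m * L ^ k) ν (L ^ m) - 1) ∘ₗ symbOp M (L ^ m * L ^ k) (sD M (L ^ m * L ^ k) ν ((L ^ m * L ^ k : ℕ) : ℝ))) ∘ₗ
            gOp M (L ^ m * L ^ k) a) := by
  have h := isAdjW_sub (isAdjW_add (isAdjW_add (isAdj_entry2 (L := L) M k m a ha μ) (isAdj_N3 M k m a ha μ)) (isAdj_N4 M k m a ha μ)) (isAdj_N5 M k m a ha μ)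
  refine isAdjW_congr h rfl ?_
  rw [entry2_adjoint_split M k m a ha μ]
  abel

end Adjoints

end Summit.QuantumFields.YangMills.BalabanUVNodes.N15.TwoGrid
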